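import Mathlib
import HarnessLib
import Literature.Analysis.Fourier.DeLaValleePoussinKernel
import Literature.Analysis.FunctionSpaces.PeriodicLogCost
import Summits.HubbardSuperconductivity.HubbardSuperconductivity.Theorems.KLProgrammeKLRegimeCountertermJacksonTranslate
import Summits.HubbardSuperconductivity.HubbardSuperconductivity.Theorems.KLProgrammeKLRegimeCountertermJacksonKernelSharp

/-!
# Route `KLProgramme`, crux K3 — engine-flow child `KLRegimeEngineV17F2` (stmt-HubbardSuperconductivity-20437), stub (C)
# `stub_twoLeg_curvature`, (C)-door «Jackson remainder in jet form» (KL STATUS l.2683 (c4a-ii)): SHARP JACKSON MOMENTS, 2-D LAYER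

Cell gate-hubbard-kl, seat hubbard-kl-k3c3-p3 (g6); builds on k3c3-p1 g5's `…CountertermJacksonKernelSharp` (p530419: Parseval
`jacksonConst_ge_sharp`, 1-D moments `3π/(2(d+1))`, `3π²/(2(d+1)²)`).  This file adds (i) the `sin²`-REFINEMENT of the second moment —
`∫₀¹ F_M·sin²(π(M+1)x) = 1/2` (the frequency `M+1` is outside the Fejér band) with the pointwise `x²F_M ≤ sin²(π(M+1)x)/(4(M+1))`
(closed form + Jordan) gives `∫x²F_M² ≤ 1/(8(M+1))`, **`∫_{−½}^{½} x²J_M ≤ 3/(16(M+1)²)`** and **`∫_{−π}^{π} s²J̃_d ≤ 3π²/(4(d+1)²)`**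
(`≈ 7.4/(d+1)²`, truth `3.0`; half of p530419's); (ii) the VARIANCE inequality `(∫|s|J̃_d)² ≤ ∫s²J̃_d`, whence **`∫|s|J̃_d ≤ π√3/(2(d+1))`**
(`≈ 2.72/(d+1)`, truth `1.32`); (iii) the 2-D product-weight moments `∫J̃J̃(s²+t²) ≤ 3π²/(2(d+1)²)`, `∫J̃J̃(|s|+|t|) ≤ π√3/(d+1)` and the SHARP
forms of the tree's translate bounds (`…CountertermJacksonTranslate`): **`‖∫J̃J̃·(H(x−w)−H(x))‖ ≤ π√3/(d+1)·‖DH‖∞`** (tree: `π⁶/(d+1)`) and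
**`≤ 3π²/(2(d+1)²)·‖D²H‖∞`** (tree: `2π⁷/(d+1)²`) — the two lemmas every (C1) estimate in the bulk of the kernel calls.
Pure analysis; nothing about the model is asserted.  Role of the smoothed frame: [cite: BenfattoGiulianiMastropietro2006] §2.2 (2.23).
-/

noncomputable section

namespace Summit.HubbardSuperconductivity.HubbardSuperconductivity.Theorems.KLRegimeSplit

set_option linter.dupNamespace false -- summit = problem name (single-conjunct summit), D-0017

open Real Finset MeasureTheory intervalIntegral Filter
open Literature.Analysis.Fourier.TrigApprox

/-! ## §1 The second moment of the period-one Jackson kernel (the `sin²` refinement: a factor 2 below `…JacksonKernelSharp`) -/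

/-- `∫₀¹ F_M(x)·sin²(π(M+1)x) dx = 1/2`: the frequency `M + 1` is outside the Fejér band. -/
theorem integral_fejer_mul_sin_sq (M : ℕ) :
    ∫ x in (0 : ℝ)..1, fejer M x * Real.sin (π * (M + 1) * x) ^ 2 = 1 / 2 := by
  have hexp : ∀ x : ℝ, fejer M x * Real.sin (π * (M + 1) * x) ^ 2 =
      fejer M x / 2 - fejer M x * Real.cos (2 * π * ((M + 1 : ℕ) : ℝ) * x) / 2 := by
    intro x
    rw [Real.sin_sq_eq_half_sub]
    push_cast
    ring_nf
  simp_rw [hexp]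
  have i1 : IntervalIntegrable (fun x => fejer M x / 2) volume 0 1 := ((continuous_fejer M).div_const _).intervalIntegrable _ _
  have i2 : IntervalIntegrable (fun x => fejer M x * Real.cos (2 * π * ((M + 1 : ℕ) : ℝ) * x) / 2) volume 0 1 :=
    (((continuous_fejer M).mul (by fun_prop)).div_const _).intervalIntegrable _ _
  rw [intervalIntegral.integral_sub i1 i2, intervalIntegral.integral_div, intervalIntegral.integral_div, integral_fejer,
    integral_fejer_mul_cos_of_lt M (Nat.lt_succ_self M)]
  norm_num

/-- **Pointwise**: `x²·F_M(x) ≤ sin²(π(M+1)x)/(4(M+1))` on `|x| ≤ ½` (closed form + Jordan). -/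
theorem sq_mul_fejer_le_sin_sq (M : ℕ) {x : ℝ} (hx : |x| ≤ 1 / 2) :
    x ^ 2 * fejer M x ≤ Real.sin (π * (M + 1) * x) ^ 2 / (4 * (M + 1)) := by
  have hM : (0 : ℝ) < M + 1 := by positivity
  have hfs := fejer_mul_sin_sq M x
  have hsin := Literature.Analysis.FunctionSpaces.Torus.four_mul_sq_le_sin_sq hx
  have hf0 := fejer_nonneg M x
  rw [le_div_iff₀ (by positivity)]
  calc x ^ 2 * fejer M x * (4 * (M + 1)) = fejer M x * (M + 1) * (4 * x ^ 2) := by ring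
    _ ≤ fejer M x * (M + 1) * Real.sin (π * x) ^ 2 := mul_le_mul_of_nonneg_left hsin (by positivity)
    _ = Real.sin (π * (M + 1) * x) ^ 2 := hfs

/-- `∫_{−½}^{½} x²·F_M(x)² dx ≤ 1/(8(M+1))`. -/
theorem integral_sq_mul_fejer_sq_le (M : ℕ) :
    ∫ x in (-(1 / 2 : ℝ))..(1 / 2), x ^ 2 * fejer M x ^ 2 ≤ 1 / (8 * (M + 1)) := by
  have hM : (0 : ℝ) < M + 1 := by positivity
  -- pointwise majorant `x² F² ≤ F·sin²(π(M+1)x)/(4(M+1))`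
  have hmaj : ∫ x in (-(1 / 2 : ℝ))..(1 / 2), x ^ 2 * fejer M x ^ 2 ≤
      ∫ x in (-(1 / 2 : ℝ))..(1 / 2), fejer M x * Real.sin (π * (M + 1) * x) ^ 2 / (4 * (M + 1)) := by
    refine intervalIntegral.integral_mono_on (by norm_num)
      (((continuous_pow 2).mul ((continuous_fejer M).pow 2)).intervalIntegrable _ _)
      ((((continuous_fejer M).mul (by fun_prop)).div_const _).intervalIntegrable _ _) fun x hx => ?_
    have hx' : |x| ≤ 1 / 2 := by rw [abs_le]; exact ⟨by linarith [hx.1], by linarith [hx.2]⟩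
    have h := sq_mul_fejer_le_sin_sq M hx'
    have hf0 := fejer_nonneg M x
    calc x ^ 2 * fejer M x ^ 2 = (x ^ 2 * fejer M x) * fejer M x := by ring
      _ ≤ (Real.sin (π * (M + 1) * x) ^ 2 / (4 * (M + 1))) * fejer M x := mul_le_mul_of_nonneg_right h hf0
      _ = fejer M x * Real.sin (π * (M + 1) * x) ^ 2 / (4 * (M + 1)) := by ring
  -- the majorant is `1`-periodic; move the window to `[0, 1]`
  have hper : Function.Periodic (fun x => fejer M x * Real.sin (π * (M + 1) * x) ^ 2 / (4 * (M + 1))) 1 := by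
    intro x
    have h1 : fejer M (x + 1) = fejer M x := by simpa using fejer_add_int M x 1
    have h2 : Real.sin (π * (M + 1) * (x + 1)) ^ 2 = Real.sin (π * (M + 1) * x) ^ 2 := by
      rw [show π * (M + 1) * (x + 1) = π * (M + 1) * x + ((M + 1 : ℕ) : ℝ) * π by push_cast; ring,
        Real.sin_add_nat_mul_pi, mul_pow, ← pow_mul, pow_mul', neg_one_sq, one_pow, one_mul]
    simp only [h1, h2]
  have hwin : ∫ x in (-(1 / 2 : ℝ))..(1 / 2), fejer M x * Real.sin (π * (M + 1) * x) ^ 2 / (4 * (M + 1)) =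
      ∫ x in (0 : ℝ)..1, fejer M x * Real.sin (π * (M + 1) * x) ^ 2 / (4 * (M + 1)) := by
    have := hper.intervalIntegral_add_eq (-(1 / 2 : ℝ)) 0
    rw [zero_add, show -(1 / 2 : ℝ) + 1 = 1 / 2 by norm_num] at this
    exact this
  rw [hwin, intervalIntegral.integral_div, integral_fejer_mul_sin_sq] at hmaj
  calc ∫ x in (-(1 / 2 : ℝ))..(1 / 2), x ^ 2 * fejer M x ^ 2 ≤ 1 / 2 / (4 * (M + 1)) := hmaj
    _ = 1 / (8 * (M + 1)) := by field_simp; ring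

/-- **Second moment of the period-one Jackson kernel**: `∫_{−½}^{½} x²·J_M(x) dx ≤ 3/(16(M+1)²)` (true value `≈ 0.076/(M+1)²`). -/
theorem integral_sq_mul_jackson_le_sharp (M : ℕ) :
    ∫ x in (-(1 / 2 : ℝ))..(1 / 2), x ^ 2 * jackson M x ≤ 3 / (16 * ((M : ℝ) + 1) ^ 2) := by
  have hM : (0 : ℝ) < M + 1 := by positivity
  have hJ := jacksonConst_pos M
  have hfun : (fun x : ℝ => x ^ 2 * jackson M x) = fun x => (jacksonConst M)⁻¹ * (x ^ 2 * fejer M x ^ 2) := by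
    funext x; simp only [jackson]; field_simp
  rw [hfun, intervalIntegral.integral_const_mul]
  have h1 := integral_sq_mul_fejer_sq_le M
  have h2 := jacksonConst_ge_sharp M
  have h3 : (jacksonConst M)⁻¹ ≤ 3 / (2 * (M + 1)) := by
    rw [inv_eq_one_div, div_le_div_iff₀ hJ (by positivity)]; linarith
  calc (jacksonConst M)⁻¹ * ∫ x in (-(1 / 2 : ℝ))..(1 / 2), x ^ 2 * fejer M x ^ 2
      ≤ (3 / (2 * (M + 1))) * (1 / (8 * (M + 1))) := by
        apply mul_le_mul h3 h1 _ (by positivity)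
        exact intervalIntegral.integral_nonneg (by norm_num) fun x _ => by positivity
    _ = 3 / (16 * ((M : ℝ) + 1) ^ 2) := by field_simp; ring


/-! ## §2 The `2π`-periodic kernel `J̃_d` and the product weight: sharp moments -/

/-- **Second moment of `J̃_d`**: `∫_{−π}^{π} s²·J̃_d(s) ds ≤ 3π²/(4(d+1)²)` (`≈ 7.4/(d+1)²`; the tree's `integral_sq_mul_jker_le` has `π⁷ ≈ 3020`). -/
theorem integral_sq_mul_jker_le_sharp' (d : ℕ) : ∫ s in (-π)..π, s ^ 2 * jker d s ≤ 3 * π ^ 2 / (4 * ((d : ℝ) + 1) ^ 2) := by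
  have h2π : (2 * π : ℝ) ≠ 0 := by positivity
  have hd : (0 : ℝ) < d + 1 := by positivity
  -- substitution `s = 2π x`
  have hsub : ∫ s in (-π)..π, s ^ 2 * jker d s = (2 * π) ^ 2 * ∫ x in (-(1 / 2 : ℝ))..(1 / 2), x ^ 2 * jackson d x := by
    have hpt : ∀ s, s ^ 2 * jker d s = (2 * π) * (fun x => x ^ 2 * jackson d x) (s / (2 * π)) := by
      intro s
      simp only [jker]
      field_simp
    rw [intervalIntegral.integral_congr fun s _ => hpt s, intervalIntegral.integral_const_mul,
      intervalIntegral.integral_comp_div (fun x => x ^ 2 * jackson d x) h2π,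
      show -π / (2 * π) = -(1 / 2 : ℝ) by field_simp, show π / (2 * π) = (1 / 2 : ℝ) by field_simp, smul_eq_mul]
    ring
  rw [hsub]
  calc (2 * π) ^ 2 * ∫ x in (-(1 / 2 : ℝ))..(1 / 2), x ^ 2 * jackson d x
      ≤ (2 * π) ^ 2 * (3 / (16 * ((d : ℝ) + 1) ^ 2)) := mul_le_mul_of_nonneg_left (integral_sq_mul_jackson_le_sharp d) (by positivity)
    _ = 3 * π ^ 2 / (4 * ((d : ℝ) + 1) ^ 2) := by field_simp; ring

/-- **The variance inequality for the probability kernel `J̃_d`**: `(∫|s|·J̃_d)² ≤ ∫ s²·J̃_d` (from `0 ≤ ∫ J̃_d·(|s| − A)²`, `∫J̃_d = 1`). -/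
theorem sq_integral_abs_mul_jker_le (d : ℕ) :
    (∫ s in (-π)..π, |s| * jker d s) ^ 2 ≤ ∫ s in (-π)..π, s ^ 2 * jker d s := by
  have hππ : -π ≤ π := by linarith [Real.pi_pos]
  set A := ∫ s in (-π)..π, |s| * jker d s with hA
  have hc := continuous_jker d
  have i0 : IntervalIntegrable (fun s => jker d s) volume (-π) π := hc.intervalIntegrable _ _
  have i1 : IntervalIntegrable (fun s => |s| * jker d s) volume (-π) π := (continuous_abs.mul hc).intervalIntegrable _ _
  have i2 : IntervalIntegrable (fun s => s ^ 2 * jker d s) volume (-π) π := ((continuous_pow 2).mul hc).intervalIntegrable _ _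
  -- `0 ≤ ∫ J̃·(|s| − A)² = ∫ s²J̃ − 2A·∫|s|J̃ + A²·∫J̃`
  have hnn : 0 ≤ ∫ s in (-π)..π, jker d s * (|s| - A) ^ 2 :=
    intervalIntegral.integral_nonneg hππ fun s _ => mul_nonneg (jker_nonneg d s) (sq_nonneg _)
  have hexp : ∫ s in (-π)..π, jker d s * (|s| - A) ^ 2 =
      (∫ s in (-π)..π, s ^ 2 * jker d s) - 2 * A * (∫ s in (-π)..π, |s| * jker d s) + A ^ 2 * ∫ s in (-π)..π, jker d s := by
    have hpt : ∀ s : ℝ, jker d s * (|s| - A) ^ 2 = (s ^ 2 * jker d s - 2 * A * (|s| * jker d s)) + A ^ 2 * jker d s := by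
      intro s; have := sq_abs s; ring_nf; rw [sq_abs]; ring
    simp_rw [hpt]
    rw [intervalIntegral.integral_add (i2.sub (i1.const_mul _)) (i0.const_mul _), intervalIntegral.integral_sub i2 (i1.const_mul _),
      intervalIntegral.integral_const_mul, intervalIntegral.integral_const_mul]
  rw [hexp, integral_jker, ← hA] at hnn
  nlinarith

/-- **First absolute moment of `J̃_d`**: `∫_{−π}^{π} |s|·J̃_d(s) ds ≤ π√3/(2(d+1))` (`≈ 2.72/(d+1)`; the tree's `integral_abs_mul_jker_le` has
`π⁶/2 ≈ 481`). -/
theorem integral_abs_mul_jker_le_sharp' (d : ℕ) : ∫ s in (-π)..π, |s| * jker d s ≤ π * Real.sqrt 3 / (2 * ((d : ℝ) + 1)) := by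
  have hππ : -π ≤ π := by linarith [Real.pi_pos]
  have hd : (0 : ℝ) < d + 1 := by positivity
  have hA0 : 0 ≤ ∫ s in (-π)..π, |s| * jker d s :=
    intervalIntegral.integral_nonneg hππ fun s _ => mul_nonneg (abs_nonneg s) (jker_nonneg d s)
  have h1 := sq_integral_abs_mul_jker_le d
  have h2 := integral_sq_mul_jker_le_sharp' d
  have hB0 : 0 ≤ π * Real.sqrt 3 / (2 * ((d : ℝ) + 1)) := by positivity
  have h3 : (π * Real.sqrt 3 / (2 * ((d : ℝ) + 1))) ^ 2 = 3 * π ^ 2 / (4 * ((d : ℝ) + 1) ^ 2) := by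
    rw [div_pow, mul_pow, Real.sq_sqrt (by norm_num)]; ring
  have h4 : (∫ s in (-π)..π, |s| * jker d s) ^ 2 ≤ (π * Real.sqrt 3 / (2 * ((d : ℝ) + 1))) ^ 2 := by
    rw [h3]; exact h1.trans h2
  exact (abs_le_of_sq_le_sq' h4 hB0).2

section Weight

variable (d : ℕ)

/-- `∫ J̃J̃·(s² + t²) dμ ≤ 3π²/(2(d+1)²)` (sharp form of `integral_jweight_mul_normSq_le`). -/
theorem integral_jweight_mul_normSq_le_sharp :
    ∫ w, jweight d w * (w.1 ^ 2 + w.2 ^ 2) ∂jmeas ≤ 3 * π ^ 2 / (2 * ((d : ℝ) + 1) ^ 2) := by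
  have hππ : -π ≤ π := by linarith [Real.pi_pos]
  have hm := integral_sq_mul_jker_le_sharp' d
  have e : (fun w : ℝ × ℝ => jweight d w * (w.1 ^ 2 + w.2 ^ 2)) =
      fun w => (w.1 ^ 2 * jker d w.1) * jker d w.2 + jker d w.1 * (w.2 ^ 2 * jker d w.2) := by
    funext w; simp only [jweight]; ring
  have hj1 : Continuous fun w : ℝ × ℝ => jker d w.1 := (continuous_jker d).comp continuous_fst
  have hj2 : Continuous fun w : ℝ × ℝ => jker d w.2 := (continuous_jker d).comp continuous_snd
  have i1 : Integrable (fun w : ℝ × ℝ => (w.1 ^ 2 * jker d w.1) * jker d w.2) jmeas :=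
    integrable_jmeas_of_continuous (((continuous_fst.pow 2).mul hj1).mul hj2)
  have i2 : Integrable (fun w : ℝ × ℝ => jker d w.1 * (w.2 ^ 2 * jker d w.2)) jmeas :=
    integrable_jmeas_of_continuous (hj1.mul ((continuous_snd.pow 2).mul hj2))
  rw [e, integral_add i1 i2,
    MeasureTheory.integral_prod_mul (μ := volume.restrict (Set.Ioc (-π) π)) (ν := volume.restrict (Set.Ioc (-π) π))
      (f := fun s => s ^ 2 * jker d s) (g := fun t => jker d t),
    MeasureTheory.integral_prod_mul (μ := volume.restrict (Set.Ioc (-π) π)) (ν := volume.restrict (Set.Ioc (-π) π))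
      (f := fun s => jker d s) (g := fun t => t ^ 2 * jker d t)]
  simp only [← intervalIntegral.integral_of_le hππ, integral_jker]
  have e2 : (∫ x in (-π)..π, x ^ 2 * jker d x) * 1 + 1 * ∫ x in (-π)..π, x ^ 2 * jker d x =
      2 * ∫ x in (-π)..π, x ^ 2 * jker d x := by ring
  rw [e2]
  have hd : (0 : ℝ) < (d : ℝ) + 1 := by positivity
  have : 2 * (3 * π ^ 2 / (4 * ((d : ℝ) + 1) ^ 2)) = 3 * π ^ 2 / (2 * ((d : ℝ) + 1) ^ 2) := by
    field_simp; ring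
  linarith

/-- `∫ J̃J̃·(|s| + |t|) dμ ≤ π√3/(d+1)` (sharp form of `integral_jweight_mul_absSum_le`). -/
theorem integral_jweight_mul_absSum_le_sharp :
    ∫ w, jweight d w * (|w.1| + |w.2|) ∂jmeas ≤ π * Real.sqrt 3 / ((d : ℝ) + 1) := by
  have hππ : -π ≤ π := by linarith [Real.pi_pos]
  have hm := integral_abs_mul_jker_le_sharp' d
  have e : (fun w : ℝ × ℝ => jweight d w * (|w.1| + |w.2|)) =
      fun w => (|w.1| * jker d w.1) * jker d w.2 + jker d w.1 * (|w.2| * jker d w.2) := by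
    funext w; simp only [jweight]; ring
  have hj1 : Continuous fun w : ℝ × ℝ => jker d w.1 := (continuous_jker d).comp continuous_fst
  have hj2 : Continuous fun w : ℝ × ℝ => jker d w.2 := (continuous_jker d).comp continuous_snd
  have i1 : Integrable (fun w : ℝ × ℝ => (|w.1| * jker d w.1) * jker d w.2) jmeas :=
    integrable_jmeas_of_continuous ((continuous_fst.abs.mul hj1).mul hj2)
  have i2 : Integrable (fun w : ℝ × ℝ => jker d w.1 * (|w.2| * jker d w.2)) jmeas :=
    integrable_jmeas_of_continuous (hj1.mul (continuous_snd.abs.mul hj2))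
  rw [e, integral_add i1 i2,
    MeasureTheory.integral_prod_mul (μ := volume.restrict (Set.Ioc (-π) π)) (ν := volume.restrict (Set.Ioc (-π) π))
      (f := fun s => |s| * jker d s) (g := fun t => jker d t),
    MeasureTheory.integral_prod_mul (μ := volume.restrict (Set.Ioc (-π) π)) (ν := volume.restrict (Set.Ioc (-π) π))
      (f := fun s => jker d s) (g := fun t => |t| * jker d t)]
  simp only [← intervalIntegral.integral_of_le hππ, integral_jker]
  have e2 : (∫ x in (-π)..π, |x| * jker d x) * 1 + 1 * ∫ x in (-π)..π, |x| * jker d x =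
      2 * ∫ x in (-π)..π, |x| * jker d x := by ring
  rw [e2]
  have hd : (0 : ℝ) < d + 1 := by positivity
  have : 2 * (π * Real.sqrt 3 / (2 * ((d : ℝ) + 1))) = π * Real.sqrt 3 / ((d : ℝ) + 1) := by field_simp
  linarith

end Weight

/-! ## §3 Sharp Jackson bounds for the weighted translate integral (vector-valued) -/

section Translate

variable (d : ℕ) {V : Type*} [NormedAddCommGroup V] [NormedSpace ℝ V] [CompleteSpace V]

omit [CompleteSpace V] in
/-- **First-order bound, sharp constant**: `‖∫ J̃J̃·(H(x − w) − H(x))‖ ≤ π√3/(d+1)·B₁` for `H ∈ C¹` with `‖DH‖ ≤ B₁`. -/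
theorem norm_integral_jweight_sub_le_first_sharp {H : EuclideanSpace ℝ (Fin 2) → V} (hH : ContDiff ℝ 1 H) {B₁ : ℝ}
    (hB : ∀ y, ‖iteratedFDeriv ℝ 1 H y‖ ≤ B₁) (x : EuclideanSpace ℝ (Fin 2)) :
    ‖∫ w, jweight d w • (H (x - jshift w) - H x) ∂jmeas‖ ≤ π * Real.sqrt 3 / (d + 1) * B₁ := by
  have hB0 : 0 ≤ B₁ := le_trans (norm_nonneg _) (hB x)
  have hint : Integrable (fun w : ℝ × ℝ => jweight d w * (B₁ * (|w.1| + |w.2|))) jmeas :=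
    integrable_jmeas_of_continuous ((continuous_jweight d).mul (continuous_const.mul (continuous_fst.abs.add continuous_snd.abs)))
  calc ‖∫ w, jweight d w • (H (x - jshift w) - H x) ∂jmeas‖
      ≤ ∫ w, ‖jweight d w • (H (x - jshift w) - H x)‖ ∂jmeas := norm_integral_le_integral_norm _
    _ ≤ ∫ w, jweight d w * (B₁ * (|w.1| + |w.2|)) ∂jmeas := by
        refine integral_mono_of_nonneg (Eventually.of_forall fun w => norm_nonneg _) hint (Eventually.of_forall fun w => ?_)
        show ‖jweight d w • (H (x - jshift w) - H x)‖ ≤ jweight d w * (B₁ * (|w.1| + |w.2|))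
        rw [norm_smul, Real.norm_eq_abs, abs_of_nonneg (jweight_nonneg d w)]
        refine mul_le_mul_of_nonneg_left ?_ (jweight_nonneg d w)
        have h := norm_sub_le_of_iteratedFDeriv_one hH hB x (jshift w)
        exact h.trans (mul_le_mul_of_nonneg_left (norm_jshift_le w) hB0)
    _ = B₁ * ∫ w, jweight d w * (|w.1| + |w.2|) ∂jmeas := by
        rw [← MeasureTheory.integral_const_mul]; exact integral_congr_ae (Eventually.of_forall fun w => by ring)
    _ ≤ B₁ * (π * Real.sqrt 3 / (d + 1)) := mul_le_mul_of_nonneg_left (integral_jweight_mul_absSum_le_sharp d) hB0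
    _ = π * Real.sqrt 3 / (d + 1) * B₁ := by ring

/-- **Second-order bound, sharp constant**: `‖∫ J̃J̃·(H(x − w) − H(x))‖ ≤ 3π²/(2(d+1)²)·B₂` for `H ∈ C²` with `‖D²H‖ ≤ B₂`
(the linear term vanishes against the even weight; the remainder is `≤ B₂(s² + t²)`). -/
theorem norm_integral_jweight_sub_le_second_sharp {H : EuclideanSpace ℝ (Fin 2) → V} (hH : ContDiff ℝ 2 H) {B₂ : ℝ}
    (hB : ∀ y, ‖iteratedFDeriv ℝ 2 H y‖ ≤ B₂) (x : EuclideanSpace ℝ (Fin 2)) :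
    ‖∫ w, jweight d w • (H (x - jshift w) - H x) ∂jmeas‖ ≤ 3 * π ^ 2 / (2 * ((d : ℝ) + 1) ^ 2) * B₂ := by
  have hB0 : 0 ≤ B₂ := le_trans (norm_nonneg _) (hB x)
  have hHc : Continuous H := hH.continuous
  have hcR : Continuous fun w : ℝ × ℝ => jweight d w • (H (x - jshift w) - H x + fderiv ℝ H x (jshift w)) :=
    (continuous_jweight d).smul (((hHc.comp (continuous_const.sub continuous_jshift)).sub continuous_const).add
      ((fderiv ℝ H x).continuous.comp continuous_jshift))
  have hcL : Continuous fun w : ℝ × ℝ => jweight d w • fderiv ℝ H x (jshift w) :=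
    (continuous_jweight d).smul ((fderiv ℝ H x).continuous.comp continuous_jshift)
  have hsplit : (∫ w, jweight d w • (H (x - jshift w) - H x) ∂jmeas) =
      (∫ w, jweight d w • (H (x - jshift w) - H x + fderiv ℝ H x (jshift w)) ∂jmeas) -
        ∫ w, jweight d w • fderiv ℝ H x (jshift w) ∂jmeas := by
    rw [← integral_sub (integrable_jmeas_of_continuous hcR) (integrable_jmeas_of_continuous hcL)]
    refine integral_congr_ae (Eventually.of_forall fun w => ?_)
    show jweight d w • (H (x - jshift w) - H x) =
      jweight d w • (H (x - jshift w) - H x + (fderiv ℝ H x) (jshift w)) - jweight d w • (fderiv ℝ H x) (jshift w)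
    rw [← smul_sub]; congr 1; abel
  rw [hsplit, integral_jweight_smul_clm_jshift, sub_zero]
  have hint : Integrable (fun w : ℝ × ℝ => jweight d w * (B₂ * (w.1 ^ 2 + w.2 ^ 2))) jmeas :=
    integrable_jmeas_of_continuous ((continuous_jweight d).mul (continuous_const.mul
      ((continuous_fst.pow 2).add (continuous_snd.pow 2))))
  calc ‖∫ w, jweight d w • (H (x - jshift w) - H x + fderiv ℝ H x (jshift w)) ∂jmeas‖
      ≤ ∫ w, ‖jweight d w • (H (x - jshift w) - H x + fderiv ℝ H x (jshift w))‖ ∂jmeas := norm_integral_le_integral_norm _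
    _ ≤ ∫ w, jweight d w * (B₂ * (w.1 ^ 2 + w.2 ^ 2)) ∂jmeas := by
        refine integral_mono_of_nonneg (Eventually.of_forall fun w => norm_nonneg _) hint (Eventually.of_forall fun w => ?_)
        show ‖jweight d w • (H (x - jshift w) - H x + fderiv ℝ H x (jshift w))‖ ≤ jweight d w * (B₂ * (w.1 ^ 2 + w.2 ^ 2))
        rw [norm_smul, Real.norm_eq_abs, abs_of_nonneg (jweight_nonneg d w), ← norm_jshift_sq]
        exact mul_le_mul_of_nonneg_left (norm_sub_sub_add_fderiv_le hH hB x (jshift w)) (jweight_nonneg d w)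
    _ = B₂ * ∫ w, jweight d w * (w.1 ^ 2 + w.2 ^ 2) ∂jmeas := by
        rw [← MeasureTheory.integral_const_mul]; exact integral_congr_ae (Eventually.of_forall fun w => by ring)
    _ ≤ B₂ * (3 * π ^ 2 / (2 * ((d : ℝ) + 1) ^ 2)) := mul_le_mul_of_nonneg_left (integral_jweight_mul_normSq_le_sharp d) hB0
    _ = 3 * π ^ 2 / (2 * ((d : ℝ) + 1) ^ 2) * B₂ := by ring

end Translate

end Summit.HubbardSuperconductivity.HubbardSuperconductivity.Theorems.KLRegimeSplit

end
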